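import Literature.Analysis.FluidPDE.ConstantinDirectionDissipationProofs
import HarnessLib

/-!
# Crux `SlicedKelvin.PlanarFluxAPriori` (stmt-NavierStokesRegularity-15600), line `Sketch`:
  STUB `stub_vorticityMassBound` — Constantin's a-priori `L¹` vorticity bound

Lands `--supports stmt-NavierStokesRegularity-15600` the registered stub `stub_vorticityMassBound` of
the lead's skeleton `Cruxes/PlanarFluxAPriori/Lines/Sketch.lean`: along a classical solution `u` of the
unforced Navier–Stokes equations on `ℝ³ × [0, T)` which is Leray–Hopf from its rapidly decaying datum,
the total vorticity mass is a priori bounded,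

  `‖curl u(t)‖_{L¹(ℝ³)} ≤ ‖curl u(0)‖_{L¹(ℝ³)} + (2ν)⁻¹ ‖u(0)‖²_{L²(ℝ³)}`  for every `t ∈ [0, T)`

(in `ℝ≥0∞`). This is P. Constantin, *Navier–Stokes equations and area of interfaces*, Comm. Math.
Phys. **129** (1990) 241–266, Thm. 2.1 / (2.22) (there on the period box; here on `ℝ³`).

## Proof

The in-tree proof of the companion bound `ν ∫∫ |ω| |∇ξ|² ≤ ‖ω₀‖₁ + (2ν)⁻¹‖u₀‖₂²`
(`Literature.Analysis.FluidPDE.constantin1990_direction_dissipation_bound_holds`, file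
`ConstantinDirectionDissipationProofs`) multiplies the vorticity equation by `ω/N`, `N = √(|ω|² + ε²)`,
against the cut-off `φ_R = cutoff R` and integrates over `(0, T') × ℝ³`:
`ν ∫₀^{T'}∫ φ Dreg_ε = ∫₀^{T'}∫ rest − ∫ φ (N(T') − ε) + ∫ φ (N(0) − ε)`; it keeps the dissipation and
drops the end term. Here we do the opposite (`vorticityMass_slab_le`): `Dreg_ε ≥ 0` pointwise
(`dirDissLow_nonneg`, `dirDissLow_le_dirDissReg`), so
`∫ φ_R (N(T') − ε) ≤ ∫ φ_R |ω(0)| + |∫₀^{T'}∫ rest|`. The remainder is `O(R^{-1/2})` by the in-tree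
`IsClassicalNSSolutionOn.abs_integral_rest_le` fed with the Leray–Hopf quantities
(`IsLerayHopfOn.lintegral_frobeniusNormSq_fderiv_of_classical`, `IsLerayHopfOn.exists_lintegral_enorm_sq_le`),
whence, with `R = k² → ∞` on each ball `B(0, m+1)` (where `φ_R = 1`) and the exhaustion
`ℝ³ = ⋃ₘ B(0, m+1)`, `∫⁻ (N_ε(ω(t)) − ε) ≤ ‖ω₀‖₁ + ∫₀ᵀ∫|∇u|²` for every `ε > 0`; monotone convergence
`N_{1/(n+1)} − 1/(n+1) ↑ |ω|` (`lintegral_enorm_eq_iSup_lintegral_regN_sub`) and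
`ν ∫₀ᵀ∫ |∇u|² ≤ ½‖u₀‖₂²` conclude. The case `t = 0` is trivial.
-/

noncomputable section

namespace Summit.NavierStokesRegularity.NavierStokesRegularity.Theorems.SlicedKelvinPlanarFluxAPriori

-- the summit and its single sub-problem share the name (CONVENTIONS §1)
set_option linter.dupNamespace false

open MeasureTheory Set Function Filter Metric Literature.Analysis.FluidPDE
open scoped RealInnerProductSpace ENNReal NNReal Laplacian Topology

/-! ### The regularised modulus `√(s² + ε²) − ε ↑ |s|` as `ε ↓ 0` -/

/-- `ε ↦ √(s² + ε²) − ε` is antitone on `[0, ∞)` (by squaring). -/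
private theorem sqrt_normSq_add_sq_sub_antitone (s : ℝ) {ε ε' : ℝ} (hε : 0 ≤ ε) (h : ε ≤ ε') :
    Real.sqrt (s ^ 2 + ε' ^ 2) - ε' ≤ Real.sqrt (s ^ 2 + ε ^ 2) - ε := by
  have h2 : Real.sqrt (s ^ 2 + ε' ^ 2) ≤ Real.sqrt (s ^ 2 + ε ^ 2) + (ε' - ε) := by
    rw [Real.sqrt_le_iff]
    refine ⟨by linarith [Real.sqrt_nonneg (s ^ 2 + ε ^ 2)], ?_⟩
    have h1 : ε ≤ Real.sqrt (s ^ 2 + ε ^ 2) := by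
      calc ε = Real.sqrt (ε ^ 2) := (Real.sqrt_sq hε).symm
        _ ≤ Real.sqrt (s ^ 2 + ε ^ 2) := Real.sqrt_le_sqrt (by nlinarith)
    nlinarith [Real.sq_sqrt (show (0 : ℝ) ≤ s ^ 2 + ε ^ 2 by positivity),
      Real.sqrt_nonneg (s ^ 2 + ε ^ 2)]
  linarith

/-- **Monotone convergence in `ε`.** For an a.e. strongly measurable field `f`, along `εₙ = 1/(n+1) ↓ 0`
the regularised moduli increase to the modulus under the lower integral:
`∫⁻ ‖f‖ₑ = ⨆ₙ ∫⁻ (√(‖f‖² + εₙ²) − εₙ)`. -/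
theorem lintegral_enorm_eq_iSup_lintegral_regN_sub {α F' : Type*} [MeasurableSpace α] {μ : Measure α}
    [NormedAddCommGroup F'] {f : α → F'} (hf : AEStronglyMeasurable f μ) :
    ∫⁻ a, ‖f a‖ₑ ∂μ = ⨆ n : ℕ, ∫⁻ a,
      ENNReal.ofReal (Real.sqrt (‖f a‖ ^ 2 + (((n : ℝ) + 1)⁻¹) ^ 2) - ((n : ℝ) + 1)⁻¹) ∂μ := by
  set g : ℕ → α → ℝ≥0∞ := fun n a =>
    ENNReal.ofReal (Real.sqrt (‖f a‖ ^ 2 + (((n : ℝ) + 1)⁻¹) ^ 2) - ((n : ℝ) + 1)⁻¹) with hg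
  have hg_meas : ∀ n, AEMeasurable (g n) μ := fun n => by
    have h1 : AEMeasurable (fun a => ‖f a‖ ^ 2 + (((n : ℝ) + 1)⁻¹) ^ 2) μ :=
      (hf.norm.aemeasurable.pow_const 2).add_const _
    exact ENNReal.measurable_ofReal.comp_aemeasurable
      ((Real.continuous_sqrt.measurable.comp_aemeasurable h1).sub_const _)
  have hg_mono : ∀ a, Monotone fun n => g n a := fun a m n hmn => by
    refine ENNReal.ofReal_le_ofReal (sqrt_normSq_add_sq_sub_antitone (‖f a‖) (by positivity) ?_)
    exact inv_anti₀ (by positivity) (by exact_mod_cast Nat.add_le_add_right hmn 1)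
  have hg_sup : ∀ a, ⨆ n, g n a = ‖f a‖ₑ := by
    intro a
    refine iSup_eq_of_tendsto (hg_mono a) ?_
    have h0 : Tendsto (fun n : ℕ => ((n : ℝ) + 1)⁻¹) atTop (𝓝 0) := by
      simpa only [one_div] using tendsto_one_div_add_atTop_nhds_zero_nat (𝕜 := ℝ)
    have h1 : Tendsto (fun n : ℕ => Real.sqrt (‖f a‖ ^ 2 + (((n : ℝ) + 1)⁻¹) ^ 2) - ((n : ℝ) + 1)⁻¹)
        atTop (𝓝 (‖f a‖ - 0)) := ((tendsto_regN_zero (f a)).comp h0).sub h0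
    rw [sub_zero] at h1
    have h2 := (ENNReal.continuous_ofReal.tendsto _).comp h1
    rw [ofReal_norm] at h2
    exact h2
  change ∫⁻ a, ‖f a‖ₑ ∂μ = ⨆ n : ℕ, ∫⁻ a, g n a ∂μ
  rw [← lintegral_iSup' hg_meas (Eventually.of_forall hg_mono)]
  exact lintegral_congr fun a => (hg_sup a).symm

/-! ### The slab inequality with the end term kept -/

section Slab

variable {ν T' : ℝ} {u : ℝ → (EuclideanSpace ℝ (Fin 3)) → (EuclideanSpace ℝ (Fin 3))}
  {p : ℝ → (EuclideanSpace ℝ (Fin 3)) → ℝ}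

/-- **The slab inequality, end term kept** (Constantin 1990, (2.9) for `q(y) = √(1 + |y|²)` integrated
over `(0, T') × ℝ³` against a nonnegative `φ ∈ C²_c`, the dissipation dropped): for a classical solution
of the unforced Navier–Stokes equations on `[0, T'] × ℝ³` (`T' > 0`, `ν ≥ 0`) and `ε > 0`,
`∫ φ (N(T') − ε) ≤ ∫ φ |ω(0)| + |∫₀^{T'}∫ rest|`, `N = √(|ω|² + ε²)`,
`rest = ν (Δφ)(N − ε) + (N − ε)(u·∇)φ + φ ⟪ω, (ω·∇)u⟫/N` (time integration of the slice identity
`IsClassicalNSSolutionOn.integral_mul_inner_timeDerivWithin_vorticity_div_regN`, `Dreg_ε ≥ 0`,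
`N(0) − ε ≤ |ω(0)|`). -/
theorem vorticityMass_slab_le
    (hns : IsClassicalNSSolutionOn (Icc 0 T') ν 0 u p) (hT' : 0 < T') (hν : 0 ≤ ν)
    {φ : (EuclideanSpace ℝ (Fin 3)) → ℝ} (hφ : ContDiff ℝ 2 φ) (hφc : HasCompactSupport φ)
    (hφ0 : ∀ x, 0 ≤ φ x) {ε : ℝ} (hε : 0 < ε) :
    ∫ x, φ x * (Real.sqrt (‖vorticity u T' x‖ ^ 2 + ε ^ 2) - ε) ≤
      (∫ x, φ x * ‖vorticity u 0 x‖) +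
      |∫ τ in Ioo 0 T', ∫ x, (ν * ((Δ φ) x * (Real.sqrt (‖vorticity u τ x‖ ^ 2 + ε ^ 2) - ε))
        + (Real.sqrt (‖vorticity u τ x‖ ^ 2 + ε ^ 2) - ε) * fderiv ℝ φ x (u τ x)
        + φ x * (⟪vorticity u τ x, fderiv ℝ (u τ) x (vorticity u τ x)⟫ /
            Real.sqrt (‖vorticity u τ x‖ ^ 2 + ε ^ 2)))| := by
  have hU : UniqueDiffOn ℝ (Icc 0 T') := uniqueDiffOn_Icc hT'
  have hε0 : ε ≠ 0 := hε.ne'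
  set w := vorticity u with hwdef
  have hw : IsSmoothSpaceTimeOn (Icc 0 T') w := hns.isSmoothSpaceTimeOn_vorticity hU
  -- joint continuity of the building blocks
  have hw_c : ContinuousOn (uncurry w) (Icc 0 T' ×ˢ univ) := hw.continuousOn
  have hu_c : ContinuousOn (uncurry u) (Icc 0 T' ×ˢ univ) := hns.smooth_velocity.continuousOn
  have hDu_c : ContinuousOn (uncurry fun τ x => fderiv ℝ (u τ) x) (Icc 0 T' ×ˢ univ) :=
    (hns.smooth_velocity.fderiv_slice hU).continuousOn
  have hN_c := continuousOn_regN_uncurry hw_c ε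
  have hNne : ∀ z ∈ Icc 0 T' ×ˢ (univ : Set (EuclideanSpace ℝ (Fin 3))),
      Real.sqrt (‖w z.1 z.2‖ ^ 2 + ε ^ 2) ≠ 0 := fun z _ => (regN_pos hε0 _).ne'
  have hφ_c : ContinuousOn (fun z : ℝ × (EuclideanSpace ℝ (Fin 3)) => φ z.2) (Icc 0 T' ×ˢ univ) :=
    (hφ.continuous.comp continuous_snd).continuousOn
  have hK : IsCompact (tsupport φ) := hφc
  have hKφ : ∀ x ∉ tsupport φ, φ x = 0 := fun x hx => image_eq_zero_of_notMem_tsupport hx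
  -- the slab functions
  set P : ℝ → (EuclideanSpace ℝ (Fin 3)) → ℝ := fun τ x => φ x * (∑ i, (‖fderiv ℝ (w τ) x ((stdOrthonormalBasis ℝ (EuclideanSpace ℝ (Fin 3))) i)‖ ^ 2 / Real.sqrt (‖(w τ) x‖ ^ 2 + ε ^ 2) - ⟪(w τ) x, fderiv ℝ (w τ) x ((stdOrthonormalBasis ℝ (EuclideanSpace ℝ (Fin 3))) i)⟫ ^ 2 / Real.sqrt (‖(w τ) x‖ ^ 2 + ε ^ 2) ^ 3)) with hP
  set Rr : ℝ → (EuclideanSpace ℝ (Fin 3)) → ℝ := fun τ x => ν * ((Δ φ) x * (Real.sqrt (‖w τ x‖ ^ 2 + ε ^ 2) - ε))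
    + (Real.sqrt (‖w τ x‖ ^ 2 + ε ^ 2) - ε) * fderiv ℝ φ x (u τ x)
    + φ x * (⟪w τ x, fderiv ℝ (u τ) x (w τ x)⟫ / Real.sqrt (‖w τ x‖ ^ 2 + ε ^ 2)) with hRr
  have hPc : ContinuousOn (uncurry P) (Icc 0 T' ×ˢ univ) :=
    hφ_c.mul (continuousOn_dirDissReg_slab hw hU hε0)
  have hRc : ContinuousOn (uncurry Rr) (Icc 0 T' ×ˢ univ) := by
    refine ((continuousOn_const.mul (((continuous_laplacian hφ).comp continuous_snd).continuousOn.mul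
      (hN_c.sub continuousOn_const))).add ((hN_c.sub continuousOn_const).mul ?_)).add
      (hφ_c.mul ((hw_c.inner (hDu_c.clm_apply hw_c)).div hN_c hNne))
    exact (((hφ.continuous_fderiv (by norm_num)).comp continuous_snd).continuousOn).clm_apply hu_c
  have hPK : ∀ τ ∈ Icc 0 T', ∀ x ∉ tsupport φ, P τ x = 0 := fun τ _ x hx => by
    simp only [hP, hKφ x hx, zero_mul]
  have hRK : ∀ τ ∈ Icc 0 T', ∀ x ∉ tsupport φ, Rr τ x = 0 := fun τ _ x hx => by
    simp only [hRr, hKφ x hx, laplacian_eq_zero_of_notMem_tsupport hx,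
      fderiv_of_notMem_tsupport ℝ hx]
    simp
  -- integrability in time of the space integrals
  have hPi := integrableOn_Ioo_integral_of_continuousOn hK hPc hPK
  have hRi := integrableOn_Ioo_integral_of_continuousOn hK hRc hRK
  -- the slice identity, for every `τ ∈ [0, T']`
  have hE1 : ∀ τ ∈ Icc 0 T', ∫ x, φ x *
      (⟪w τ x, Literature.Analysis.FluidPDE.timeDerivWithin (Icc 0 T') w τ x⟫ / Real.sqrt (‖w τ x‖ ^ 2 + ε ^ 2)) =
      -(ν * ∫ x, P τ x) + ∫ x, Rr τ x := fun τ hτ =>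
    hns.integral_mul_inner_timeDerivWithin_vorticity_div_regN hT' hτ hφ hφc hε0
  -- time integration of the left-hand side
  have hD := integral_Ioo_integral_mul_inner_timeDerivWithin_div_regN hw hT' hφ.continuous hφc hε0 ε
  have hcongr : ∫ τ in Ioo 0 T', ∫ x, φ x *
      (⟪w τ x, Literature.Analysis.FluidPDE.timeDerivWithin (Icc 0 T') w τ x⟫ / Real.sqrt (‖w τ x‖ ^ 2 + ε ^ 2)) =
      ∫ τ in Ioo 0 T', (-(ν * ∫ x, P τ x) + ∫ x, Rr τ x) :=
    setIntegral_congr_fun measurableSet_Ioo fun τ hτ => hE1 τ (Ioo_subset_Icc_self hτ)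
  have hsplit : ∫ τ in Ioo 0 T', (-(ν * ∫ x, P τ x) + ∫ x, Rr τ x) =
      -(ν * ∫ τ in Ioo 0 T', ∫ x, P τ x) + ∫ τ in Ioo 0 T', ∫ x, Rr τ x := by
    rw [integral_add ?_ hRi, integral_neg, integral_const_mul]
    exact (hPi.const_mul ν).neg
  -- the datum term
  have hA0 : ∫ x, φ x * (Real.sqrt (‖w 0 x‖ ^ 2 + ε ^ 2) - ε) ≤ ∫ x, φ x * ‖w 0 x‖ := by
    have h0I : (0 : ℝ) ∈ Icc 0 T' := ⟨le_rfl, hT'.le⟩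
    have hc0 : Continuous (w 0) := (hw.contDiff_slice h0I).continuous
    refine integral_mono ?_ ?_ fun x => ?_
    · exact (hφ.continuous.mul ((((hc0.norm.pow 2).add continuous_const).sqrt).sub
        continuous_const)).integrable_of_hasCompactSupport hφc.mul_right
    · exact (hφ.continuous.mul hc0.norm).integrable_of_hasCompactSupport hφc.mul_right
    · exact mul_le_mul_of_nonneg_left (regN_sub_le_norm hε.le _) (hφ0 x)
  -- the dissipation is nonnegative
  have hP0 : 0 ≤ ν * ∫ τ in Ioo 0 T', ∫ x, P τ x := by
    refine mul_nonneg hν (integral_nonneg fun τ => integral_nonneg fun x => ?_)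
    exact mul_nonneg (hφ0 x) ((dirDissLow_nonneg ε (w τ) x).trans
      (dirDissLow_le_dirDissReg hε0 (w τ) x))
  -- conclude
  have key : ∫ x, φ x * (Real.sqrt (‖w T' x‖ ^ 2 + ε ^ 2) - ε) =
      (∫ τ in Ioo 0 T', ∫ x, Rr τ x) + (∫ x, φ x * (Real.sqrt (‖w 0 x‖ ^ 2 + ε ^ 2) - ε))
        - ν * ∫ τ in Ioo 0 T', ∫ x, P τ x := by
    have := hD
    rw [hcongr, hsplit] at this
    linarith
  rw [key]
  linarith [le_abs_self (∫ τ in Ioo 0 T', ∫ x, Rr τ x)]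

end Slab

/-! ### The bound at a positive time, for `ε > 0` -/

section Final

variable {ν T : ℝ} {u : ℝ → (EuclideanSpace ℝ (Fin 3)) → (EuclideanSpace ℝ (Fin 3))}
  {p : ℝ → (EuclideanSpace ℝ (Fin 3)) → ℝ}

/-- **The regularised bound at a positive time.** For a classical solution on `[0, T)` which is
Leray–Hopf from `u 0` with `‖curl u(0)‖ ∈ L¹`, `0 < t < T` and `ε > 0`:
`∫⁻ (√(|ω(t)|² + ε²) − ε) ≤ ofReal (‖ω₀‖₁ + ∫₀ᵀ∫ |∇u|²_F)`. The slab inequality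
`vorticityMass_slab_le` on `[0, t]` with `φ = cutoff (k²)` and the remainder bound
`IsClassicalNSSolutionOn.abs_integral_rest_le` (`λ = k³`, error `err k → 0`), then `k → ∞` on each
ball `B(0, m+1)` (where the cut-off is `1`) and the exhaustion `ℝ³ = ⋃ₘ B(0, m+1)`. -/
theorem lintegral_regN_sub_curl_le
    (hns : IsClassicalNSSolutionOn (Ico 0 T) ν 0 u p) (hlh : IsLerayHopfOn T ν 0 (u 0) u)
    (hν : 0 ≤ ν) (hT : 0 < T) (hω₀ : Integrable fun x => ‖curl (u 0) x‖) {t : ℝ} (ht0 : 0 < t)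
    (htT : t < T) {ε : ℝ} (hε : 0 < ε) :
    ∫⁻ x, ENNReal.ofReal (Real.sqrt (‖curl (u t) x‖ ^ 2 + ε ^ 2) - ε) ≤
      ENNReal.ofReal ((∫ x, ‖curl (u 0) x‖) +
        (∫⁻ τ in Ioo 0 T, ∫⁻ x, ENNReal.ofReal (frobeniusNormSq (fderiv ℝ (u τ) x))).toReal) := by
  -- data
  obtain ⟨hDfin, -⟩ := IsLerayHopfOn.lintegral_frobeniusNormSq_fderiv_of_classical hns hlh hT
  set D := ∫⁻ τ in Ioo 0 T, ∫⁻ x, ENNReal.ofReal (frobeniusNormSq (fderiv ℝ (u τ) x)) with hDdef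
  obtain ⟨CE, hCEfin, hCE⟩ := IsLerayHopfOn.exists_lintegral_enorm_sq_le hlh
  obtain ⟨C₁, hC₁0, hC₁⟩ := exists_norm_fderiv_cutoff_le (E := (EuclideanSpace ℝ (Fin 3)))
  obtain ⟨C₂, hC₂0, hC₂⟩ := exists_abs_laplacian_cutoff_le (E := (EuclideanSpace ℝ (Fin 3)))
  set V₁ : ℝ := (volume (ball (0 : (EuclideanSpace ℝ (Fin 3))) 1)).toReal with hV₁
  set Kω : ℝ := ∫ x, ‖curl (u 0) x‖ with hKω
  have hDr0 : 0 ≤ D.toReal := ENNReal.toReal_nonneg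
  have hCEr0 : 0 ≤ CE.toReal := ENNReal.toReal_nonneg
  have hV₁0 : 0 ≤ V₁ := ENNReal.toReal_nonneg
  have hu0 : ContDiff ℝ 1 (u 0) := (hns.contDiff_velocity ⟨le_rfl, hT⟩).of_le (by exact_mod_cast le_top)
  have hut : ContDiff ℝ 1 (u t) := (hns.contDiff_velocity ⟨ht0.le, htT⟩).of_le (by exact_mod_cast le_top)
  -- the classical solution on the closed slab `[0, t]`
  have hns' : IsClassicalNSSolutionOn (Icc 0 t) ν 0 u p :=
    hns.mono (Icc_subset_Ico_right htT) (uniqueDiffOn_Icc ht0)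
  -- the error function
  set err : ℕ → ℝ := fun k => (ν * C₂ / k + C₁ / k ^ 2) * D.toReal + 4 * ν * C₂ * T * V₁ / k
    + C₁ / (2 * k ^ 2) * CE.toReal with herr
  have herr_tendsto : Tendsto err atTop (𝓝 0) := by
    have h1 : Tendsto (fun k : ℕ => (k : ℝ)⁻¹) atTop (𝓝 0) := tendsto_inv_atTop_nhds_zero_nat
    have h2 : Tendsto (fun k : ℕ => ((k : ℝ) ^ 2)⁻¹) atTop (𝓝 0) := by
      simpa using h1.pow 2
    have : Tendsto (fun k : ℕ => (ν * C₂ * (k : ℝ)⁻¹ + C₁ * ((k : ℝ) ^ 2)⁻¹) * D.toReal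
        + 4 * ν * C₂ * T * V₁ * (k : ℝ)⁻¹ + C₁ / 2 * ((k : ℝ) ^ 2)⁻¹ * CE.toReal) atTop (𝓝 0) := by
      have := ((((h1.const_mul (ν * C₂)).add (h2.const_mul C₁)).mul_const D.toReal).add
        (h1.const_mul (4 * ν * C₂ * T * V₁))).add ((h2.const_mul (C₁ / 2)).mul_const CE.toReal)
      simpa using this
    refine this.congr fun k => ?_
    simp only [herr]; ring
  -- the real bound from the slab inequality, for `k ≥ 1`, `R = k²`, `λ = k³`
  have hreal : ∀ k : ℕ, 1 ≤ k →
      ∫ x, cutoff ((k : ℝ) ^ 2) x * (Real.sqrt (‖vorticity u t x‖ ^ 2 + ε ^ 2) - ε) ≤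
        Kω + D.toReal + err k := by
    intro k hk
    have hk0 : (0 : ℝ) < k := by exact_mod_cast hk
    set R : ℝ := (k : ℝ) ^ 2 with hRdef
    have hR : 0 < R := by positivity
    have hslab := vorticityMass_slab_le hns' ht0 hν (contDiff_cutoff R) (hasCompactSupport_cutoff hR)
      (cutoff_nonneg R) hε
    -- the datum term
    have hdat : ∫ x, cutoff R x * ‖vorticity u 0 x‖ ≤ Kω := by
      refine integral_mono ?_ hω₀ fun x => ?_
      · exact ((contDiff_cutoff (n := 0) R).continuous.mul (continuous_curl hu0).norm)
          |>.integrable_of_hasCompactSupport (hasCompactSupport_cutoff hR).mul_right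
      · exact mul_le_of_le_one_left (norm_nonneg _) (cutoff_le_one R x)
    -- the remainder term
    have hD' : ∫⁻ τ in Ioo 0 t, ∫⁻ x, ENNReal.ofReal (frobeniusNormSq (fderiv ℝ (u τ) x)) ≤ D :=
      lintegral_Ioo_mono le_rfl htT.le
    have hCE' : ∫⁻ τ in Ioo 0 t, ∫⁻ x, ‖u τ x‖ₑ ^ 2 ≤ CE :=
      (lintegral_Ioo_mono le_rfl htT.le).trans hCE
    have hrest := hns'.abs_integral_rest_le ht0 hν hε hR (hC₁ R hR) (hC₂ R hR) hDfin hD' hCEfin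
      hCE' (lam := (k : ℝ) ^ 3) (by positivity)
    -- the volume of the ball of radius `2R`
    have hvol : (volume (closedBall (0 : (EuclideanSpace ℝ (Fin 3))) (2 * R))).toReal =
        (2 * R) ^ 3 * V₁ := by
      rw [Measure.addHaar_closedBall _ _ (by positivity : (0 : ℝ) ≤ 2 * R), ENNReal.toReal_mul,
        ENNReal.toReal_ofReal (by positivity), finrank_euclideanSpace, Fintype.card_fin]
    rw [hvol] at hrest
    -- algebra
    have hcoef₁ : (ν * (C₂ / R ^ 2) * (k : ℝ) ^ 3 + C₁ / R + 1) * D.toReal =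
        D.toReal + (ν * C₂ / k + C₁ / k ^ 2) * D.toReal := by
      rw [hRdef]; field_simp; ring
    have hcoef₂ : ν * (C₂ / R ^ 2) / (2 * (k : ℝ) ^ 3) * (t * ((2 * R) ^ 3 * V₁)) =
        4 * ν * C₂ * t * V₁ / k := by
      rw [hRdef]; field_simp; ring
    have hcoef₃ : C₁ / (2 * R) * CE.toReal = C₁ / (2 * k ^ 2) * CE.toReal := by rw [hRdef]
    have htle : 4 * ν * C₂ * t * V₁ / k ≤ 4 * ν * C₂ * T * V₁ / k := by gcongr
    rw [hcoef₁, hcoef₂, hcoef₃] at hrest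
    have : Kω + D.toReal + err k = Kω + (D.toReal + (ν * C₂ / k + C₁ / k ^ 2) * D.toReal
        + 4 * ν * C₂ * T * V₁ / k + C₁ / (2 * k ^ 2) * CE.toReal) := by
      simp only [herr]; ring
    rw [this]
    linarith
  -- on the balls `B(0, m+1)`: `k → ∞`
  have hball : ∀ m : ℕ, ∫⁻ x in ball (0 : (EuclideanSpace ℝ (Fin 3))) ((m : ℝ) + 1),
      ENNReal.ofReal (Real.sqrt (‖curl (u t) x‖ ^ 2 + ε ^ 2) - ε) ≤ ENNReal.ofReal (Kω + D.toReal) := by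
    intro m
    have hlim : Tendsto (fun k : ℕ => ENNReal.ofReal (Kω + D.toReal + err k)) atTop
        (𝓝 (ENNReal.ofReal (Kω + D.toReal))) := by
      refine (ENNReal.continuous_ofReal.tendsto _).comp ?_
      simpa using (tendsto_const_nhds (x := Kω + D.toReal)).add herr_tendsto
    refine ge_of_tendsto hlim ?_
    filter_upwards [eventually_ge_atTop (m + 1)] with k hk
    have hk1 : 1 ≤ k := le_trans (Nat.le_add_left 1 m) hk
    have hk0 : (0 : ℝ) < k := by exact_mod_cast hk1
    set R : ℝ := (k : ℝ) ^ 2 with hRdef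
    have hR : 0 < R := by positivity
    have hmR : (m : ℝ) + 1 ≤ R := by
      have h1 : (m : ℝ) + 1 ≤ k := by exact_mod_cast hk
      have h2 : (k : ℝ) ≤ (k : ℝ) ^ 2 := by nlinarith
      exact h1.trans h2
    have hint : Integrable fun x => cutoff R x * (Real.sqrt (‖curl (u t) x‖ ^ 2 + ε ^ 2) - ε) :=
      ((contDiff_cutoff (n := 0) R).continuous.mul
        ((((continuous_curl hut).norm.pow 2).add continuous_const).sqrt.sub continuous_const))
        |>.integrable_of_hasCompactSupport (hasCompactSupport_cutoff hR).mul_right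
    have hnn : 0 ≤ᵐ[volume] fun x => cutoff R x * (Real.sqrt (‖curl (u t) x‖ ^ 2 + ε ^ 2) - ε) :=
      Eventually.of_forall fun x => mul_nonneg (cutoff_nonneg R x) (regN_sub_nonneg hε.le _)
    calc ∫⁻ x in ball (0 : (EuclideanSpace ℝ (Fin 3))) ((m : ℝ) + 1),
          ENNReal.ofReal (Real.sqrt (‖curl (u t) x‖ ^ 2 + ε ^ 2) - ε)
        = ∫⁻ x in ball (0 : (EuclideanSpace ℝ (Fin 3))) ((m : ℝ) + 1),
            ENNReal.ofReal (cutoff R x * (Real.sqrt (‖curl (u t) x‖ ^ 2 + ε ^ 2) - ε)) := by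
          refine setLIntegral_congr_fun measurableSet_ball fun x hx => ?_
          rw [cutoff_eq_one hR ((mem_ball_zero_iff.1 hx).le.trans hmR), one_mul]
      _ ≤ ∫⁻ x, ENNReal.ofReal (cutoff R x * (Real.sqrt (‖curl (u t) x‖ ^ 2 + ε ^ 2) - ε)) :=
          setLIntegral_le_lintegral _ _
      _ = ENNReal.ofReal (∫ x, cutoff R x * (Real.sqrt (‖curl (u t) x‖ ^ 2 + ε ^ 2) - ε)) :=
          (ofReal_integral_eq_lintegral_ofReal hint hnn).symm
      _ ≤ ENNReal.ofReal (Kω + D.toReal + err k) := ENNReal.ofReal_le_ofReal (hreal k hk1)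
  -- exhaustion of `ℝ³` by the balls
  have hdir : Directed (· ⊆ ·) fun m : ℕ => ball (0 : (EuclideanSpace ℝ (Fin 3))) ((m : ℝ) + 1) :=
    Monotone.directed_le fun a b hab => ball_subset_ball (by exact_mod_cast Nat.succ_le_succ hab)
  have hexh : ∫⁻ x, ENNReal.ofReal (Real.sqrt (‖curl (u t) x‖ ^ 2 + ε ^ 2) - ε) =
      ⨆ m : ℕ, ∫⁻ x in ball (0 : (EuclideanSpace ℝ (Fin 3))) ((m : ℝ) + 1),
        ENNReal.ofReal (Real.sqrt (‖curl (u t) x‖ ^ 2 + ε ^ 2) - ε) := by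
    rw [← setLIntegral_iUnion_of_directed _ hdir, iUnion_ball_nat_succ, setLIntegral_univ]
  rw [hexh]
  exact iSup_le hball

/-! ### The a-priori `L¹` vorticity bound -/

/-- **stub `stub_vorticityMassBound` — Constantin's a-priori `L¹` vorticity bound** (P. Constantin,
Comm. Math. Phys. 129 (1990), Thm. 2.1, (2.22)): along a classical solution of the unforced
Navier–Stokes equations on `ℝ³ × [0, T)` which is Leray–Hopf from its rapidly decaying datum,
`‖curl u(t)‖_{L¹(ℝ³)} ≤ ‖curl u(0)‖_{L¹} + (2ν)⁻¹‖u(0)‖²_{L²}` for every `t ∈ [0, T)` (in `ℝ≥0∞`).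
For `t = 0` this is `le_self_add`; for `t > 0`, `lintegral_regN_sub_curl_le` for `ε = 1/(n+1)`,
monotone convergence `lintegral_enorm_eq_iSup_lintegral_regN_sub`, and the energy inequality
`ν ∫₀ᵀ∫ |∇u|²_F ≤ ½‖u₀‖₂²` (`IsLerayHopfOn.lintegral_frobeniusNormSq_fderiv_of_classical`). -/
theorem stub_vorticityMassBound :
    ∀ (ν T : ℝ), 0 < ν → 0 < T → ∀ (u : ℝ → EuclideanSpace ℝ (Fin 3) → EuclideanSpace ℝ (Fin 3))
      (p : ℝ → EuclideanSpace ℝ (Fin 3) → ℝ),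
      Literature.Analysis.FluidPDE.IsClassicalNSSolutionOn (Set.Ico 0 T) ν 0 u p →
      Literature.Analysis.FluidPDE.IsLerayHopfOn T ν 0 (u 0) u →
      Literature.Analysis.FluidPDE.HasRapidSpatialDecay (u 0) →
      ∀ t ∈ Set.Ico 0 T, ∫⁻ x, ‖Literature.Analysis.FluidPDE.curl (u t) x‖ₑ ≤
        (∫⁻ x, ‖Literature.Analysis.FluidPDE.curl (u 0) x‖ₑ) +
          (ENNReal.ofReal (2 * ν))⁻¹ * ∫⁻ x, ‖u 0 x‖ₑ ^ 2 := by
  intro ν T hν hT u p hns hlh hdec t ht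
  rcases ht.1.eq_or_lt with h0 | ht0
  · subst h0
    exact le_self_add
  -- data
  have h0T : (0 : ℝ) ∈ Ico 0 T := ⟨le_rfl, hT⟩
  have hu0 : ContDiff ℝ 1 (u 0) := (hns.contDiff_velocity h0T).of_le (by exact_mod_cast le_top)
  have hut : ContDiff ℝ 1 (u t) := (hns.contDiff_velocity ht).of_le (by exact_mod_cast le_top)
  have hω₀ : Integrable fun x => ‖curl (u 0) x‖ := integrable_norm_curl_of_hasRapidSpatialDecay hu0 hdec
  obtain ⟨-, hDE⟩ := IsLerayHopfOn.lintegral_frobeniusNormSq_fderiv_of_classical hns hlh hT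
  set D := ∫⁻ τ in Ioo 0 T, ∫⁻ x, ENNReal.ofReal (frobeniusNormSq (fderiv ℝ (u τ) x)) with hDdef
  set Kω : ℝ := ∫ x, ‖curl (u 0) x‖ with hKω
  have hKω0 : 0 ≤ Kω := integral_nonneg fun x => norm_nonneg _
  have hDr0 : 0 ≤ D.toReal := ENNReal.toReal_nonneg
  -- `ε = 1/(n+1) → 0` by monotone convergence
  have hmain : ∫⁻ x, ‖curl (u t) x‖ₑ ≤ ENNReal.ofReal (Kω + D.toReal) := by
    rw [lintegral_enorm_eq_iSup_lintegral_regN_sub (continuous_curl hut).aestronglyMeasurable]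
    exact iSup_le fun n => lintegral_regN_sub_curl_le hns hlh hν.le hT hω₀ ht0 ht.2 (by positivity)
  refine hmain.trans ?_
  -- `ofReal (‖ω₀‖₁ + ∫₀ᵀ∫ |∇u|²) ≤ ∫⁻ ‖ω₀‖ₑ + (2ν)⁻¹ ∫⁻ ‖u₀‖ₑ²`
  have hK : ENNReal.ofReal Kω = ∫⁻ x, ‖curl (u 0) x‖ₑ := by
    rw [hKω, ofReal_integral_eq_lintegral_ofReal hω₀ (Eventually.of_forall fun x => norm_nonneg _)]
    exact lintegral_congr fun x => ofReal_norm _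
  have hu₀ : Integrable fun x => ‖u 0 x‖ ^ 2 :=
    (hlh.memLp 0 ⟨le_rfl, hT.le⟩).integrable_norm_pow two_ne_zero
  have hDle : ENNReal.ofReal D.toReal ≤ (ENNReal.ofReal (2 * ν))⁻¹ * ∫⁻ x, ‖u 0 x‖ₑ ^ 2 := by
    have h1 : D.toReal ≤ (2 * ν)⁻¹ * ∫ x, ‖u 0 x‖ ^ 2 := by
      rw [VectorCalculus.kineticEnergy] at hDE
      calc D.toReal = ν⁻¹ * (ν * D.toReal) := by field_simp
        _ ≤ ν⁻¹ * (2⁻¹ * ∫ x, ‖u 0 x‖ ^ 2) := by gcongr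
        _ = (2 * ν)⁻¹ * ∫ x, ‖u 0 x‖ ^ 2 := by ring
    calc ENNReal.ofReal D.toReal ≤ ENNReal.ofReal ((2 * ν)⁻¹ * ∫ x, ‖u 0 x‖ ^ 2) :=
          ENNReal.ofReal_le_ofReal h1
      _ = (ENNReal.ofReal (2 * ν))⁻¹ * ∫⁻ x, ‖u 0 x‖ₑ ^ 2 := by
          rw [ENNReal.ofReal_mul (by positivity), ENNReal.ofReal_inv_of_pos (by positivity),
            ofReal_integral_sq_norm hu₀]
  rw [ENNReal.ofReal_add hKω0 hDr0, hK]
  gcongr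

end Final

end Summit.NavierStokesRegularity.NavierStokesRegularity.Theorems.SlicedKelvinPlanarFluxAPriori
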